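/-
Copyright (c) 2026 the pub-hodgecm-mathlib formalisation cell (harness21).  Prover seat hodgecm-mathlib-F0P2-p10 (g4), Track B ∕ R90-TF, h413 = `stmt-HodgeConjecture-24833`,
R90-TF section S8 «ContSpec-n½», socket (E) :276, E1-PLANCHEREL BODY brick PB-1c-1 (S8 dealer R90-CS-plan (g4) S8-R280 (1); joint census `R90/S8/CENSUS-PlancherelBody-bricks.K2E1-p16-F0P2-p10.md` §PB-1):
THE JUNCTION for the INTERTWINED bracket `[Ψ₂]_β` of MW's inner-product formula II.2.1 on `U(2,1)_{L∕L⁺}`, hypothesis-first AFTER the Fubini step (named letter `hFub`): from `[Ψ₂]_β` in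
idele-class currency to the Mellin line (`HITS` head, self-associate pair) or to `0` (`MISSES` head, Tate's Lemma B), by ★ PB-1b-ii §2 (Tate at `(‖x‖‖x‖)⁻¹`) and ★ PB-1c-0 (Parseval II at `r^{−3}`).
-/
import Summits.HodgeConjecture.HodgeConjecture.Theorems.K2E1ChiPseudoEisensteinBracketsCMThree             -- ★ PB-1a p865168: the brackets `[Ψ₁]_β`, `[Ψ₂]_β` (brings ★ C2 constant term, ★ AVG₃, the U3 pair Defs)
import Summits.HodgeConjecture.HodgeConjecture.Theorems.K2E1MellinParsevalIntertwinedCMThree               -- ★ PB-1c-0 p865290: N = 3 Parseval II `setIntegral_mul_cpow_neg_three_mul_conj_integral_eq`, `integral_mul_cpow_two_sub_eq`; brings ★ PB-1b-ii p865252 §2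
import Summits.HodgeConjecture.HodgeConjecture.Theorems.K2E1IdeleClassCharacterOrthogonality               -- ★ GR-χ: Lemma B on `𝓕_I` `setIntegral_ideleClass_smul_mul_eq_zero_of_not_isNormTwist`
import HarnessLib

/-!
# PB-1c-1 — `K2E1ChiPseudoEisensteinBracketTwoMellinCMThree`: THE INTERTWINED BRACKET `[Ψ₂]_β` FROM IDELE-CLASS CURRENCY TO THE MELLIN LINE (JUNCTION, AFTER FUBINI)

Track B ∕ R90-TF, crux h413 = `stmt-HodgeConjecture-24833`, route of record `HCCMUnconditional`; cell `hodgecm-mathlib`, R90-TF programme, section S8 «ContSpec-n½», socket (E)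
(B ED. 7 :276): the E1-PLANCHEREL BODY cut into bricks PB-1…PB-4 (S8-R254).  ★ PB-1a p865168: `⟨θ_{f,φ}, θ_{f′,φ′}⟩_X = c_μ·([Ψ₁]_β + [Ψ₂]_β)` with
`Ψ₂ = (f∘H)φ·conj(CT θ′ − (f′∘H)φ′)`; ★ PB-1b p865195 + p865252 settle `[Ψ₁]_β`; ★ PB-1c-0 p865290 is the scalar Parseval II at `r^{−3}`.  By ★ C2
`borelConstantTerm_eisensteinSeriesU_comp_borelHeight_mul_cm_three`, `CT θ′(g) − f′(Hg)φ′(g) = (ν𝓕)⁻¹•∫_{N(𝔸)} f′(H(w₀vg))·φ′(w₀vg) dν(v)` =: `𝓘(g)` (section-generic, no continuation).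
THE L PART (analytic hand, NOT this file): Mellin inversion of `f′` inside `∫_{N(𝔸)}` and FUBINI `N(𝔸) × {Re w = c₀}` in the Godement range `c₀ > 2`, then the `G`-unfolding of
`β·(f∘H)φ·conj((M(w₀,w)φ′)·H^{2−w̄})` to the idele classes — it delivers `[Ψ₂]_β` IN IDELE-CLASS CURRENCY, in one of two shapes according as the reflected pair `w₀(χ₁,χ₂)` MISSES or
HITS `(χ₁,χ₂)`.  THIS FILE is the JUNCTION after that step, hypothesis-first on the named letter `hFub` (an EQUATION hypothesis, not a `Prop`-valued fact):
* `HITS` (self-associate): `hFub : [Ψ₂]_β = K′·∫_{𝓕_I} (‖x‖‖x‖)⁻¹•(f(‖x‖)·conj((2π)⁻¹∫ g̃(w)·c(w)·‖x‖^{2−w} dy′)) dν_I` with `c(w) = ⟪φ, M(w₀,w)φ′⟩_{K_U}` a continuous bounded scalar on `Re w = σ₀ ≥ 1`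
  ⟹ **`[Ψ₂]_β = K′·V·(2π)⁻¹∫_ℝ f̃(z)·conj g̃(z̄)·conj c(z̄) dy`** (`V = idelicCovolume`; ★ PB-1b-ii §2 Tate + ★ PB-1c-0 HEAD-a; §1 supplies the measurability of the intertwined profile);
* `MISSES` (non-self-associate): `hFub : [Ψ₂]_β = K′·∫_{𝓕_I} (‖x‖‖x‖)⁻¹•(χ(x)·Φ(‖x‖)) dν_I` with `χ` (the quotient of the pair by its reflection) NOT a norm twist ⟹ **`[Ψ₂]_β = 0`** (★ GR-χ Lemma B).
§2 states both junctions for ANY number field `K` and an abstract left side `B`; §3 specialises `B := [Ψ₂]_β` on `U(2,1)_{L∕L⁺}` literally (★ PB-1a's integrand), so the heads `rw` into ★ PB-1a.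
THEOREMS ONLY (no `def`, no `instance`, no notation, no named-fact hypothesis, no `sorry`; default heartbeats); lane `--supports stmt-HodgeConjecture-24833 --as helper` (count-neutral).

HONEST LABEL.  A junction: it FIXES THE CURRENCY the analytic hand must deliver (`hFub`) and pays nothing itself; PB-1c proper (the Fubini ∕ unfolding step) and PB-2 (contour shift)
are untouched.  HC_CM is proved only modulo the 7 printed citations (2 remaining named inputs: hLiu418 = `stmt-HodgeConjecture-24832`, h413 = `stmt-HodgeConjecture-24833`) until
rung 0 closes; this file pays nothing at the (E) socket; count-neutral.  [cite: MoeglinWaldspurger1995, II.1.7, II.2.1] [cite: TateThesis1967, §4.3, Thm. 4.4.1]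
-/

set_option autoImplicit false
set_option linter.dupNamespace false  -- the mandated namespace repeats the summit's segment (`HodgeConjecture.HodgeConjecture`)

noncomputable section

open MeasureTheory Measure Set Filter Topology Complex NumberField IsDedekindDomain MulAction
open scoped Real NNReal ENNReal ComplexConjugate
open Literature.MeasureTheory.Group Literature.NumberTheory
open Literature.NumberTheory.Automorphic Literature.NumberTheory.Automorphic.UnitaryGroup AdelicGroupData
open Literature.NumberTheory.GaloisRepresentations (HeckeCharacter ideleGroup)
open Literature.NumberTheory.Automorphic.Arthur2013.Leaves.TECR
open Summit.HodgeConjecture.HodgeConjecture.Cruxes.H413.K2E1BorelEisensteinU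
open Summit.HodgeConjecture.HodgeConjecture.Cruxes.H413.K2E1CharacterEisensteinU2Defs
open Summit.HodgeConjecture.HodgeConjecture.Cruxes.H413.K2E1CharacterEisensteinU3PairDefs
open Summit.HodgeConjecture.HodgeConjecture.Cruxes.H413.K2E1MellinPaleyWienerHalfLine (differentiable_mellin)
open Summit.HodgeConjecture.HodgeConjecture.Cruxes.H413.K2E1PseudoEisensteinInnerProductCMTwo (continuousAt_integral_mellin_mul_cpow)
open Summit.HodgeConjecture.HodgeConjecture.Cruxes.H413.K2E1IdeleClassCharacterOrthogonality (setIntegral_ideleClass_smul_mul_eq_zero_of_not_isNormTwist)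
open Summit.HodgeConjecture.HodgeConjecture.Cruxes.H413.K2E1ChiPseudoEisensteinBracketOneMellinCMThree (setIntegral_mul_inv_ideleNorm_smul_comp_eq)
open Summit.HodgeConjecture.HodgeConjecture.Cruxes.H413.K2E1MellinParsevalIntertwinedCMThree (integral_mul_cpow_two_sub_eq setIntegral_mul_cpow_neg_three_mul_conj_integral_eq)

namespace Summit.HodgeConjecture.HodgeConjecture.Cruxes.H413.K2E1ChiPseudoEisensteinBracketTwoMellinCMThree

/-! ## §1 The intertwined radial profile `r ↦ f(r)·conj((2π)⁻¹∫ g̃(w)·c(w)·r^{2−w} dy′)` is continuous on `(0,∞)`, hence `u ↦ Φ(e^u)` is measurable -/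

section Profile

variable {f g : ℝ → ℂ}

/-- **`(M₃g)` is continuous at every `r₀ > 0`**: `r ↦ ∫ g̃(w)·c(w)·r^{2−w} dy′` (`w = σ₀+iy′`, `σ₀ ≥ 1`, `g ∈ C²_c((0,∞))`, `c` continuous bounded on the line) — near `r₀` it is `r·(M₂g)(r)`
(★ PB-1c-0 `integral_mul_cpow_two_sub_eq`) and `M₂g` is continuous there (★ `continuousAt_integral_mellin_mul_cpow`, dominated convergence). [cite: MoeglinWaldspurger1995, II.1.4] -/
theorem continuousAt_integral_mellin_mul_cpow_two_sub (hg : ContDiff ℝ 2 g) (hgs : HasCompactSupport g) (hg0 : tsupport g ⊆ Ioi 0) {σ₀ : ℝ} (hσ₀ : 1 ≤ σ₀)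
    {c : ℂ → ℂ} (hcc : Continuous fun y : ℝ => c ((σ₀ : ℂ) + y * I)) {C₀ : ℝ} (hcb : ∀ y : ℝ, ‖c ((σ₀ : ℂ) + y * I)‖ ≤ C₀) {r₀ : ℝ} (hr₀ : 0 < r₀) :
    ContinuousAt (fun r : ℝ => ∫ y : ℝ, mellin g (-((σ₀ : ℂ) + y * I)) * c ((σ₀ : ℂ) + y * I) * (r : ℂ) ^ (2 - ((σ₀ : ℂ) + y * I))) r₀ := by
  have h2 : ContinuousAt (fun r : ℝ => (∫ y : ℝ, mellin g (-((σ₀ : ℂ) + y * I)) * c ((σ₀ : ℂ) + y * I) * (r : ℂ) ^ (1 - ((σ₀ : ℂ) + y * I))) * (r : ℂ)) r₀ :=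
    (continuousAt_integral_mellin_mul_cpow hg hgs hg0 hσ₀ hcc hcb hr₀).mul continuous_ofReal.continuousAt
  refine h2.congr (Filter.eventuallyEq_of_mem (Ioi_mem_nhds hr₀) fun r hr => ?_)
  exact (integral_mul_cpow_two_sub_eq (fun y : ℝ => mellin g (-((σ₀ : ℂ) + y * I))) c σ₀ hr).symm

/-- **The intertwined radial profile along `exp` is continuous**: `u ↦ f(e^u)·conj(κ·(M₃g)(e^u))` (any constant `κ`), by §1 and `e^u > 0`. [cite: MoeglinWaldspurger1995, II.1.4] -/
theorem continuous_mul_conj_integral_comp_exp (hfc : Continuous f) (hg : ContDiff ℝ 2 g) (hgs : HasCompactSupport g) (hg0 : tsupport g ⊆ Ioi 0) {σ₀ : ℝ} (hσ₀ : 1 ≤ σ₀)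
    {c : ℂ → ℂ} (hcc : Continuous fun y : ℝ => c ((σ₀ : ℂ) + y * I)) {C₀ : ℝ} (hcb : ∀ y : ℝ, ‖c ((σ₀ : ℂ) + y * I)‖ ≤ C₀) (κ : ℂ) :
    Continuous fun u : ℝ => f (Real.exp u) *
      conj (κ * ∫ y : ℝ, mellin g (-((σ₀ : ℂ) + y * I)) * c ((σ₀ : ℂ) + y * I) * ((Real.exp u : ℝ) : ℂ) ^ (2 - ((σ₀ : ℂ) + y * I))) := by
  have hM : Continuous fun u : ℝ => ∫ y : ℝ, mellin g (-((σ₀ : ℂ) + y * I)) * c ((σ₀ : ℂ) + y * I) * ((Real.exp u : ℝ) : ℂ) ^ (2 - ((σ₀ : ℂ) + y * I)) :=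
    continuous_iff_continuousAt.2 fun u =>
      (continuousAt_integral_mellin_mul_cpow_two_sub hg hgs hg0 hσ₀ hcc hcb (Real.exp_pos u)).comp Real.continuous_exp.continuousAt
  exact (hfc.comp Real.continuous_exp).mul (continuous_conj.comp (continuous_const.mul hM))

end Profile

/-! ## §2 The two junctions over any number field `K` (abstract left side `B`) -/

section Junction

variable {K : Type} [Field K] [NumberField K]
variable [MeasurableSpace (GaloisRepresentations.ideleGroup K)] [BorelSpace (GaloisRepresentations.ideleGroup K)]

/-- **JUNCTION `HITS` (self-associate pair), any number field.**  If a quantity `B` (the intertwined bracket `[Ψ₂]_β` after Fubini and unfolding) equals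
`K′·∫_𝓕 (‖x‖‖x‖)⁻¹•(f(‖x‖)·conj((2π)⁻¹∫ g̃(w)·c(w)·‖x‖^{2−w} dy′)) dν` over an idele class domain `𝓕` (`ν` left-invariant, finite on compacta), with `f ∈ C_c((0,∞))`, `g ∈ C²_c((0,∞))`,
`σ₀ ≥ 1`, `c` continuous bounded on `Re w = σ₀`, then **`B = K′·V·(2π)⁻¹∫_ℝ mellin f(−z)·conj (mellin g (−z̄))·conj c(z̄) dy`** (`V = idelicCovolume K ν`) — ★ PB-1b-ii §2 (Tate's `d^×x` at the
weight `(‖x‖‖x‖)⁻¹`, measurability from §1) then ★ PB-1c-0 HEAD-a (Parseval II at `r^{−3}`). [cite: MoeglinWaldspurger1995, II.2.1] [cite: TateThesis1967, §4.3] -/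
theorem eq_mul_mellin_of_eq_setIntegral_ideleClass_intertwined (ν : Measure (GaloisRepresentations.ideleGroup K)) [ν.IsMulLeftInvariant] [IsFiniteMeasureOnCompacts ν]
    {𝓕 : Set (GaloisRepresentations.ideleGroup K)} (h𝓕 : IsIdeleClassDomain K 𝓕)
    {f g : ℝ → ℂ} (hfc : Continuous f) (hfs : HasCompactSupport f) (hf0 : tsupport f ⊆ Ioi 0)
    (hg : ContDiff ℝ 2 g) (hgs : HasCompactSupport g) (hg0 : tsupport g ⊆ Ioi 0) {σ₀ : ℝ} (hσ₀ : 1 ≤ σ₀)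
    {c : ℂ → ℂ} (hcc : Continuous fun y : ℝ => c ((σ₀ : ℂ) + y * I)) {C₀ : ℝ} (hcb : ∀ y : ℝ, ‖c ((σ₀ : ℂ) + y * I)‖ ≤ C₀) {K' : ℝ} {B : ℂ}
    (hFub : B = (K' : ℂ) * ∫ x in 𝓕, ((IdeleClassGroup.ideleNorm K x : ℝ) * (IdeleClassGroup.ideleNorm K x : ℝ))⁻¹ •
      (f (IdeleClassGroup.ideleNorm K x : ℝ) * conj ((((2 * π)⁻¹ : ℝ) : ℂ) * ∫ y : ℝ, mellin g (-((σ₀ : ℂ) + y * I)) * c ((σ₀ : ℂ) + y * I) *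
        ((IdeleClassGroup.ideleNorm K x : ℝ) : ℂ) ^ (2 - ((σ₀ : ℂ) + y * I)))) ∂ν) :
    B = (K' : ℂ) * ((idelicCovolume K ν).toReal : ℂ) *
      ((((2 * π)⁻¹ : ℝ) : ℂ) * ∫ y : ℝ, mellin f (-((σ₀ : ℂ) + y * I)) * conj (mellin g (-conj ((σ₀ : ℂ) + y * I))) * conj (c (conj ((σ₀ : ℂ) + y * I)))) := by
  rw [hFub, setIntegral_mul_inv_ideleNorm_smul_comp_eq ν h𝓕
      (φ := fun r : ℝ => f r * conj ((((2 * π)⁻¹ : ℝ) : ℂ) * ∫ y : ℝ, mellin g (-((σ₀ : ℂ) + y * I)) * c ((σ₀ : ℂ) + y * I) * (r : ℂ) ^ (2 - ((σ₀ : ℂ) + y * I))))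
      (continuous_mul_conj_integral_comp_exp hfc hg hgs hg0 hσ₀ hcc hcb _).aestronglyMeasurable,
    Complex.real_smul, ← setIntegral_mul_cpow_neg_three_mul_conj_integral_eq hfc hfs hf0 hg hgs hg0 σ₀ hcc hcb, mul_assoc]
  congr 2
  refine setIntegral_congr_fun measurableSet_Ioi fun r _ => ?_
  ring

/-- **JUNCTION `MISSES` (non-self-associate pair), any number field — Tate's Lemma B.**  If `B = K′·∫_𝓕 (‖x‖‖x‖)⁻¹•(χ(x)·Φ(‖x‖)) dν` over an idele class domain `𝓕` with `χ` a Hecke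
character that is NOT a norm twist (the quotient of the pair by its `w₀`-reflection) and `Φ` any radial profile, then **`B = 0`** — ★ GR-χ
`setIntegral_ideleClass_smul_mul_eq_zero_of_not_isNormTwist` (the weight `(‖x‖‖x‖)⁻¹` and `Φ(‖x‖)` are invariant under norm-one translations). [cite: TateThesis1967, Thm. 4.4.1 (Lemma B)] -/
theorem eq_zero_of_eq_setIntegral_ideleClass_of_not_isNormTwist (ν : Measure (GaloisRepresentations.ideleGroup K)) [ν.IsMulLeftInvariant]
    {𝓕 : Set (GaloisRepresentations.ideleGroup K)} (h𝓕 : IsIdeleClassDomain K 𝓕) {χ : HeckeCharacter K} (hχ : ¬ χ.IsNormTwist) (Φ : ℝ → ℂ) {K' : ℂ} {B : ℂ}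
    (hFub : B = K' * ∫ x in 𝓕, ((IdeleClassGroup.ideleNorm K x : ℝ) * (IdeleClassGroup.ideleNorm K x : ℝ))⁻¹ • (((χ x : ℂˣ) : ℂ) * Φ (IdeleClassGroup.ideleNorm K x : ℝ)) ∂ν) :
    B = 0 := by
  rw [hFub, setIntegral_ideleClass_smul_mul_eq_zero_of_not_isNormTwist ν h𝓕 hχ (fun a ha x => by rw [map_mul, ha, one_mul]) (fun a ha x => by rw [map_mul, ha, one_mul]), mul_zero]

end Junction

/-! ## §3 HEADS on `U(2,1)_{L∕L⁺}`: `B := [Ψ₂]_β` literally (★ PB-1a's integrand) -/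

section Head

variable (L : Type) [Field L] [NumberField L] [IsCMField L]
variable [MeasurableSpace (quasiSplit (↥(maximalRealSubfield L)) L (IsCMField.complexConj L) 3).Adelic]
variable [MeasurableSpace (AdeleRing (𝓞 L) L)ˣ] [BorelSpace (AdeleRing (𝓞 L) L)ˣ]

/-- **PB-1c-1 `HITS` — THE INTERTWINED BRACKET ON THE MELLIN LINE (self-associate pair), hypothesis-first after Fubini.**  Data: any measure `ν_G` on `G(𝔸)`, weight `β`, coefficient
`(f∘H)·φ` and series `θ′ = E((f′∘H)·φ′)` with its constant term along `(ν, 𝓕)` — exactly ★ PB-1a's `Ψ₂ = (f∘H)φ·conj(CT θ′ − (f′∘H)φ′)`; a Haar measure `ν_I` on `𝕀_L` and an idele class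
domain `𝓕_I`; `f ∈ C_c((0,∞))`, `f′ ∈ C²_c((0,∞))`, `σ₀ ≥ 1`, a continuous bounded scalar `c` on `Re w = σ₀` (`= ⟪φ, M(w₀,w)φ′⟩_{K_U}`).  NAMED LETTER `hFub` (the analytic hand's
Fubini ∕ unfolding step, [MoeglinWaldspurger1995] II.1.7 + II.2.1): `[Ψ₂]_β = K′·∫_{𝓕_I} (‖x‖‖x‖)⁻¹•(f(‖x‖)·conj((2π)⁻¹∫ mellin f′(−w)·c(w)·‖x‖^{2−w} dy′)) dν_I`.  CONCLUSION:
**`[Ψ₂]_β = K′·V·(2π)⁻¹ ∫_ℝ mellin f(−z)·conj (mellin f′ (−z̄))·conj c(z̄) dy`**, `V = idelicCovolume L ν_I` (§2 `HITS`).  With ★ PB-1a and ★ PB-1b this is MW's two-term inner-product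
formula for `θ_{f,φ}` on `U(2,1)` modulo `hFub`. [cite: MoeglinWaldspurger1995, II.2.1] [cite: TateThesis1967, §4.3] -/
theorem integral_weight_smul_wTwo_eq_mellin_of_idele_cm_three
    (νG : Measure (quasiSplit (↥(maximalRealSubfield L)) L (IsCMField.complexConj L) 3).Adelic) (νI : Measure (AdeleRing (𝓞 L) L)ˣ) [νI.IsHaarMeasure]
    {𝓕I : Set (AdeleRing (𝓞 L) L)ˣ} (h𝓕I : IsIdeleClassDomain L 𝓕I)
    (ν : Measure ↥(adelicUnipotent (↥(maximalRealSubfield L)) L (IsCMField.complexConj L) 3)) (𝓕 : Set ↥(adelicUnipotent (↥(maximalRealSubfield L)) L (IsCMField.complexConj L) 3))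
    (β : (quasiSplit (↥(maximalRealSubfield L)) L (IsCMField.complexConj L) 3).Adelic → ℝ≥0∞) (φ φ' : (quasiSplit (↥(maximalRealSubfield L)) L (IsCMField.complexConj L) 3).Adelic → ℂ)
    {f f' : ℝ → ℂ} (hfc : Continuous f) (hfs : HasCompactSupport f) (hf0 : tsupport f ⊆ Ioi 0)
    (hf' : ContDiff ℝ 2 f') (hf's : HasCompactSupport f') (hf'0 : tsupport f' ⊆ Ioi 0) {σ₀ : ℝ} (hσ₀ : 1 ≤ σ₀)
    {c : ℂ → ℂ} (hcc : Continuous fun y : ℝ => c ((σ₀ : ℂ) + y * I)) {C₀ : ℝ} (hcb : ∀ y : ℝ, ‖c ((σ₀ : ℂ) + y * I)‖ ≤ C₀) {K' : ℝ}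
    (hFub : ∫ g : (quasiSplit (↥(maximalRealSubfield L)) L (IsCMField.complexConj L) 3).Adelic, (β g).toReal • (f (borelHeight g : ℝ) * φ g * conj (borelConstantTerm ν 𝓕 (eisensteinSeriesU (fun g : (quasiSplit (↥(maximalRealSubfield L)) L (IsCMField.complexConj L) 3).Adelic => f' (borelHeight g : ℝ) * φ' g)) g - f' (borelHeight g : ℝ) * φ' g)) ∂νG =
      (K' : ℂ) * ∫ x in 𝓕I, ((IdeleClassGroup.ideleNorm L x : ℝ) * (IdeleClassGroup.ideleNorm L x : ℝ))⁻¹ •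
        (f (IdeleClassGroup.ideleNorm L x : ℝ) * conj ((((2 * π)⁻¹ : ℝ) : ℂ) * ∫ y : ℝ, mellin f' (-((σ₀ : ℂ) + y * I)) * c ((σ₀ : ℂ) + y * I) *
          ((IdeleClassGroup.ideleNorm L x : ℝ) : ℂ) ^ (2 - ((σ₀ : ℂ) + y * I)))) ∂νI) :
    ∫ g : (quasiSplit (↥(maximalRealSubfield L)) L (IsCMField.complexConj L) 3).Adelic, (β g).toReal • (f (borelHeight g : ℝ) * φ g * conj (borelConstantTerm ν 𝓕 (eisensteinSeriesU (fun g : (quasiSplit (↥(maximalRealSubfield L)) L (IsCMField.complexConj L) 3).Adelic => f' (borelHeight g : ℝ) * φ' g)) g - f' (borelHeight g : ℝ) * φ' g)) ∂νG =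
      (K' : ℂ) * ((idelicCovolume L νI).toReal : ℂ) *
        ((((2 * π)⁻¹ : ℝ) : ℂ) * ∫ y : ℝ, mellin f (-((σ₀ : ℂ) + y * I)) * conj (mellin f' (-conj ((σ₀ : ℂ) + y * I))) * conj (c (conj ((σ₀ : ℂ) + y * I)))) := by
  haveI := t2Space_adeleRing_of_numberField L
  haveI := locallyCompactSpace_adeleRing' L
  exact eq_mul_mellin_of_eq_setIntegral_ideleClass_intertwined νI h𝓕I hfc hfs hf0 hf' hf's hf'0 hσ₀ hcc hcb hFub

/-- **PB-1c-1 `MISSES` — THE INTERTWINED BRACKET VANISHES (non-self-associate pair), hypothesis-first after Fubini.**  Same `Ψ₂` data; NAMED LETTER `hFub`: after Fubini and unfolding,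
`[Ψ₂]_β = K′·∫_{𝓕_I} (‖x‖‖x‖)⁻¹•(χ(x)·Φ(‖x‖)) dν_I` with `χ` (the quotient of `(χ₁,χ₂)` by its `w₀`-reflection, ★ `K2E1ChiIntertwinedSectionU3.chi_torus_last_eq_reflectChar`) NOT a norm
twist and `Φ` a radial profile.  CONCLUSION: **`[Ψ₂]_β = 0`** (§2 `MISSES`, Tate's Lemma B ★ GR-χ) — the `w = w₀` term of MW II.2.1 is absent off the self-associate locus, as in ★ C4 §1.
[cite: MoeglinWaldspurger1995, II.2.1] [cite: TateThesis1967, Thm. 4.4.1 (Lemma B)] -/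
theorem integral_weight_smul_wTwo_eq_zero_of_idele_cm_three
    (νG : Measure (quasiSplit (↥(maximalRealSubfield L)) L (IsCMField.complexConj L) 3).Adelic) (νI : Measure (AdeleRing (𝓞 L) L)ˣ) [νI.IsHaarMeasure]
    {𝓕I : Set (AdeleRing (𝓞 L) L)ˣ} (h𝓕I : IsIdeleClassDomain L 𝓕I)
    (ν : Measure ↥(adelicUnipotent (↥(maximalRealSubfield L)) L (IsCMField.complexConj L) 3)) (𝓕 : Set ↥(adelicUnipotent (↥(maximalRealSubfield L)) L (IsCMField.complexConj L) 3))
    (β : (quasiSplit (↥(maximalRealSubfield L)) L (IsCMField.complexConj L) 3).Adelic → ℝ≥0∞) (φ φ' : (quasiSplit (↥(maximalRealSubfield L)) L (IsCMField.complexConj L) 3).Adelic → ℂ)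
    (f f' : ℝ → ℂ) {χ : HeckeCharacter L} (hχ : ¬ χ.IsNormTwist) (Φ : ℝ → ℂ) {K' : ℂ}
    (hFub : ∫ g : (quasiSplit (↥(maximalRealSubfield L)) L (IsCMField.complexConj L) 3).Adelic, (β g).toReal • (f (borelHeight g : ℝ) * φ g * conj (borelConstantTerm ν 𝓕 (eisensteinSeriesU (fun g : (quasiSplit (↥(maximalRealSubfield L)) L (IsCMField.complexConj L) 3).Adelic => f' (borelHeight g : ℝ) * φ' g)) g - f' (borelHeight g : ℝ) * φ' g)) ∂νG =
      K' * ∫ x in 𝓕I, ((IdeleClassGroup.ideleNorm L x : ℝ) * (IdeleClassGroup.ideleNorm L x : ℝ))⁻¹ • (((χ x : ℂˣ) : ℂ) * Φ (IdeleClassGroup.ideleNorm L x : ℝ)) ∂νI) :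
    ∫ g : (quasiSplit (↥(maximalRealSubfield L)) L (IsCMField.complexConj L) 3).Adelic, (β g).toReal • (f (borelHeight g : ℝ) * φ g * conj (borelConstantTerm ν 𝓕 (eisensteinSeriesU (fun g : (quasiSplit (↥(maximalRealSubfield L)) L (IsCMField.complexConj L) 3).Adelic => f' (borelHeight g : ℝ) * φ' g)) g - f' (borelHeight g : ℝ) * φ' g)) ∂νG = 0 := by
  haveI := t2Space_adeleRing_of_numberField L
  haveI := locallyCompactSpace_adeleRing' L
  exact eq_zero_of_eq_setIntegral_ideleClass_of_not_isNormTwist νI h𝓕I hχ Φ hFub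

end Head

end Summit.HodgeConjecture.HodgeConjecture.Cruxes.H413.K2E1ChiPseudoEisensteinBracketTwoMellinCMThree

end
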